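import Summits.Ventures.CertifiedManyBodySolver.Observables.PairWordD4
import Summits.Ventures.CertifiedManyBodySolver.Rows.DopedTLCorr
import HarnessLib

/-!
# Ventures/CertifiedManyBodySolver — Observables/PairWordD4Orbit.lean

HONEST FRAMING: first certified bounds on pairing observables; not a superconductivity verdict; every number certified or
labelled float. (hubbard-obs cell, obs-lit seat, requested by hubbard-obs-p1; zero compute, no certificate, no number, no definition,
no named fact.)

**The `D₄`-ORBIT ROW of the `d`-wave pair two-point word reads as the orbit MEAN of the named pair correlator.**
Two corollaries of hubbard-obs-p1's `expect_d4Emb_dWavePairWord` (Observables/PairWordD4.lean: the `D₄`-transported pair word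
`Γ(d4Emb γ w Λ)(Γ P_xᴴ · Γ P_y)` has expectation `ω.dWavePairCorr (γx + w) (γy + w)` in EVERY infinite-volume state):
* `re_orbitMean_dWavePairWord_eq` — `|S|⁻¹ Σ_{γ∈S} Re ω_{γΛ}(Γ(d4Emb γ 0 Λ)(Γ P_0ᴴ · Γ P_r)) = |S|⁻¹ Σ_{γ∈S} Re ω.dWavePairCorr 0 (γ r)`
  (`Λ = pairRegion 0 ∪ pairRegion r`), i.e. the conclusion of the point-group-reduced TL certificate cell
  `SquareTTPrimeCorrOrbitLowerRow … S Λ X` for the pair word IS the `D₄`-orbit mean `P̄_d(class r)` of `P_d = Re ω.dWavePairCorr 0 ·`;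
* `squareTTPrimeCorrOrbitLowerRow_dWavePair_iff` — the orbit LOWER cell on the pair word ⇔ the same trailing-binder sentence with conclusion
  `q ≤ |S|⁻¹ Σ_{γ∈S} Re ω.dWavePairCorr 0 (d4Vec γ r)` (the leg-(f) reading of eng-1's leg-J 'P̄_d class(r)' rows; M3′ wrapper
  `m3CorrOrbitLowerRow_dWavePair_iff`);
* `re_orbitMean_dWavePairCorr_univ_zero` — at `r = 0` the full-group orbit mean is `Re P_d(0)` itself.
References: D. J. Scalapino, Phys. Rep. 250 (1995) 329, §2 eq. (2.3)–(2.4) [Scalapino1995]; J. Wang et al., PRX 14 (2024) 031006, §III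
(symmetry-reduced certificates conclude on orbit means) [WangEtAl2024].
-/

noncomputable section

namespace Summit.Ventures.CertifiedManyBodySolver.Observables

open Matrix Finset Literature.MathematicalPhysics.QuantumLattice Literature.Probability.LatticeModels
open Literature.MathematicalPhysics.QuantumLattice.ThermodynamicLimit
open scoped ComplexOrder BigOperators

/-- **The `D₄`-orbit mean of the transported pair word is the orbit mean of the named pair correlator**:
`|S|⁻¹ Σ_{γ∈S} Re ω_{γΛ}(Γ(d4Emb γ 0 Λ) (Γ P_0ᴴ · Γ P_r)) = |S|⁻¹ Σ_{γ∈S} Re ω.dWavePairCorr 0 (γr)` (`d4Vec γ 0 = 0`).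
[cite: Scalapino1995, §2 eq. (2.4)] -/
theorem re_orbitMean_dWavePairWord_eq (ω : InfVolFermionState 2) (S : Finset (DihedralGroup 4)) (r : Site 2) :
    (S.card : ℝ)⁻¹ * ∑ γ ∈ S,
        (ω.expect (d4ShiftSet γ 0 (pairRegion (insert (0 : Site 2) unitSteps) 0 ∪ pairRegion (insert (0 : Site 2) unitSteps) r))
          (fermionEmbed (PolySite.d4Emb γ 0 (pairRegion (insert (0 : Site 2) unitSteps) 0 ∪ pairRegion (insert (0 : Site 2) unitSteps) r))
            (fermionEmbed (PolySite.incl Finset.subset_union_left)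
                (localPairAt (insert (0 : Site 2) unitSteps) dWaveFormFactor 0)ᴴ *
              fermionEmbed (PolySite.incl Finset.subset_union_right)
                (localPairAt (insert (0 : Site 2) unitSteps) dWaveFormFactor r)))).re =
      (S.card : ℝ)⁻¹ * ∑ γ ∈ S, (ω.dWavePairCorr 0 (d4Vec γ r)).re := by
  refine congrArg (fun s : ℝ => (S.card : ℝ)⁻¹ * s) (Finset.sum_congr rfl fun γ _ => ?_)
  rw [expect_d4Emb_dWavePairWord, add_zero, add_zero, (d4Vec_eq_zero_iff γ 0).2 rfl]

/-- **Orbit LOWER rows on the pair word ⇔ the sentence on `P_d`**: `SquareTTPrimeCorrOrbitLowerRow tp U n u q S Λ X` for the pair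
two-point word `X = Γ P_0ᴴ · Γ P_r` on `Λ = pairRegion 0 ∪ pairRegion r` holds iff, for every torus limit `ω` of the cell's class with
`energyDensityTT' 1 tp U n ≤ u`, `q ≤ |S|⁻¹ Σ_{γ∈S} Re ω.dWavePairCorr 0 (γr)`. [cite: WangEtAl2024, §III] -/
theorem squareTTPrimeCorrOrbitLowerRow_dWavePair_iff (tp U n : ℝ) (u q : ℚ) (S : Finset (DihedralGroup 4)) (r : Site 2) :
    SquareTTPrimeCorrOrbitLowerRow tp U n u q S
        (pairRegion (insert (0 : Site 2) unitSteps) 0 ∪ pairRegion (insert (0 : Site 2) unitSteps) r)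
        (fermionEmbed (PolySite.incl Finset.subset_union_left)
            (localPairAt (insert (0 : Site 2) unitSteps) dWaveFormFactor 0)ᴴ *
          fermionEmbed (PolySite.incl Finset.subset_union_right)
            (localPairAt (insert (0 : Site 2) unitSteps) dWaveFormFactor r)) ↔
      ∀ (ω : InfVolFermionState 2) (Ls : ℕ → ℕ) (ψ : ∀ L, Fock (Orb (FermionTorus 2 L))),
        Filter.Tendsto Ls Filter.atTop Filter.atTop →
        (∀ j, IsGroundStateInSector (hubbardTorusTT' (Ls j) 1 tp U) (rectN n (Ls j)) 0 (ψ (Ls j))) →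
        (∀ j, star (ψ (Ls j)) ⬝ᵥ ψ (Ls j) = 1) → ω.IsTorusLimitOf ψ Ls →
        energyDensityTT' 1 tp U n ≤ ((u : ℚ) : ℝ) →
        ((q : ℚ) : ℝ) ≤ (S.card : ℝ)⁻¹ * ∑ γ ∈ S, (ω.dWavePairCorr 0 (d4Vec γ r)).re := by
  unfold SquareTTPrimeCorrOrbitLowerRow
  refine forall_congr' fun ω => forall_congr' fun Ls => forall_congr' fun ψ => forall_congr' fun _ =>
    forall_congr' fun _ => forall_congr' fun _ => forall_congr' fun _ => forall_congr' fun _ => ?_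
  rw [re_orbitMean_dWavePairWord_eq]

/-- M3′ wrapper (`U = 8`, `n = 7/8`): `M3CorrOrbitLowerRow tp u q S Λ X` for the pair word at `(0, r)` ⇔ the `P_d` orbit-mean sentence.
[cite: WangEtAl2024, §III] -/
theorem m3CorrOrbitLowerRow_dWavePair_iff (tp : ℝ) (u q : ℚ) (S : Finset (DihedralGroup 4)) (r : Site 2) :
    M3CorrOrbitLowerRow tp u q S
        (pairRegion (insert (0 : Site 2) unitSteps) 0 ∪ pairRegion (insert (0 : Site 2) unitSteps) r)
        (fermionEmbed (PolySite.incl Finset.subset_union_left)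
            (localPairAt (insert (0 : Site 2) unitSteps) dWaveFormFactor 0)ᴴ *
          fermionEmbed (PolySite.incl Finset.subset_union_right)
            (localPairAt (insert (0 : Site 2) unitSteps) dWaveFormFactor r)) ↔
      ∀ (ω : InfVolFermionState 2) (Ls : ℕ → ℕ) (ψ : ∀ L, Fock (Orb (FermionTorus 2 L))),
        Filter.Tendsto Ls Filter.atTop Filter.atTop →
        (∀ j, IsGroundStateInSector (hubbardTorusTT' (Ls j) 1 tp 8) (rectN (7 / 8) (Ls j)) 0 (ψ (Ls j))) →
        (∀ j, star (ψ (Ls j)) ⬝ᵥ ψ (Ls j) = 1) → ω.IsTorusLimitOf ψ Ls →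
        energyDensityTT' 1 tp 8 (7 / 8) ≤ ((u : ℚ) : ℝ) →
        ((q : ℚ) : ℝ) ≤ (S.card : ℝ)⁻¹ * ∑ γ ∈ S, (ω.dWavePairCorr 0 (d4Vec γ r)).re :=
  squareTTPrimeCorrOrbitLowerRow_dWavePair_iff tp 8 (7 / 8) u q S r

/-- For the FULL group the orbit mean at `r = 0` is `Re P_d(0)` itself (`d4Vec γ 0 = 0`). [cite: Scalapino1995, §2] -/
theorem re_orbitMean_dWavePairCorr_univ_zero (ω : InfVolFermionState 2) :
    ((Finset.univ : Finset (DihedralGroup 4)).card : ℝ)⁻¹ * ∑ γ ∈ (Finset.univ : Finset (DihedralGroup 4)),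
        (ω.dWavePairCorr 0 (d4Vec γ 0)).re = (ω.dWavePairCorr 0 0).re := by
  have h0 : ∀ γ : DihedralGroup 4, d4Vec γ 0 = 0 := fun γ => (d4Vec_eq_zero_iff γ 0).2 rfl
  simp only [h0, Finset.sum_const, nsmul_eq_mul]
  have hc : ((Finset.univ : Finset (DihedralGroup 4)).card : ℝ) ≠ 0 := by
    exact_mod_cast Finset.card_ne_zero.2 Finset.univ_nonempty
  rw [← mul_assoc, inv_mul_cancel₀ hc, one_mul]

end Summit.Ventures.CertifiedManyBodySolver.Observables

end
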